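import Mathlib
import HarnessLib
import HarnessLib.Audit
import Summits.CriticalPhenomena.Statement
import Summits.CriticalPhenomena.CardyFormulaZ2.Theorems.CardyBondTriangularDiscretisationBridge
import HarnessLib.Audit.Status.Attr

/-!
Route: CardyDiluteOrbit

DORMANT since 2026-08-26T07:51:24Z (reconciler: no traction for 8.4 d (last activity item-evidence-added at 2026-08-17T21:54:40Z); parked, not closed — `ledger route dormant route-CriticalPhenomena-CardyDiluteOrbit --off` to reactivate) — unstaffed, not closed; items shared with open routes are served there. `ledger route dormant <id> --off` reactivates.

# Route CardyDiluteOrbit — Smirnov's hexagon is the θ=π/3 column of ℤ²'s n=1 Izergin–Korepin family;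
Glazman–Manolescu column migration carries its boundary law to ℤ², RSW first

It suffices to show X = CardyIK ∧ IKBondBridge (card izergin-korepin-honeycomb-degeneration, spine:
Y1 = CardyIK, Y2 = IKBondBridge).
CardyIK: the ISOTROPIC n = 1 Izergin–Korepin / Nienhuis percolation model on δℤ² — cells = ℤ²,
colours with corner fugacity
t = √3/2, fair saddle coins; written here EXPLICITLY as a function of i.i.d. bits (colour of (k,j) =
A_k ⊕ B_j ⊕ parity of the
i.i.d. Bernoulli(2√3−3) plaquette parities in the rectangle [0,k)×[0,j); coins fair) — satisfies
Cardy's formula in every conformal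
rectangle (crude embedded crossing event). IKBondBridge: its crude crossing probabilities differ
from those of bond-ℤ² at p = ½ by
o(1). The anchor is Smirnov's theorem: the θ = π/3 column of the same family (plaquette parities
fair, anti-diagonal forced) IS site
percolation on 𝕋, and the columns of the Glazman–Manolescu rhombic half-plane H(Θ), Θ ∈ {π/3,
π/2}^ℕ, can be permuted by the n = 1
Yang–Baxter hexagon identity (IKHexagonYangBaxter, verified here) — so boundary connection laws are
Θ-independent
(BoundaryLawInvariance) once box crossings are uniform in Θ (IKMixedBoxCrossing, rank 2: RSW without
FKG). Same target family as
route CardyIKTransport (card ik-isotropic-cle6-transport); this is the ALTERNATIVE DECOMPOSITION: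
explicit typed model, exact boundary
laws by column migration (GlazmanManolescu2019 Thm 1 at n = 1) before any bulk transport, RSW for
the mixed {π/3, π/2} family first.
Lean: `(∀ R : Literature.Probability.RandomPlanarGeometry.ConformalRectangle, R.HasCrossingLimit
(let μ := (Literature.Probability.Percolation.sitePercolation ℤ
Literature.Probability.Percolation.half).prod ((Literature.Probability.Percolation.sitePercolation ℤ
Literature.Probability.Percolation.half).prod ((Literature.Probability.Percolation.sitePercolation
(Literature.Probability.LatticeModels.Site 2) (Set.projIcc (0:ℝ) 1 zero_le_one (2 * Real.sqrt 3 -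
3))).prod ((Literature.Probability.Percolation.sitePercolation
(Literature.Probability.LatticeModels.Site 2) Literature.Probability.Percolation.half).prod
(Literature.Probability.Percolation.sitePercolation (Literature.Probability.LatticeModels.Site 2)
Literature.Probability.Percolation.half)))); let par : (Set ℤ × (Set ℤ × (Set
(Literature.Probability.LatticeModels.Site 2) × (Set (Literature.Probability.LatticeModels.Site 2) ×
Set (Literature.Probability.LatticeModels.Site 2))))) → Literature.Probability.LatticeModels.Site 2
→ Prop := fun ω f => (f 0 ∈ (Set.univ : Set ℤ) ∧ f ∈ ω.2.2.1) ∨ (f 0 ∉ (Set.univ : Set ℤ) ∧ f ∈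
ω.2.2.2.1); let blk : (Set ℤ × (Set ℤ × (Set (Literature.Probability.LatticeModels.Site 2) × (Set
(Literature.Probability.LatticeModels.Site 2) × Set (Literature.Probability.LatticeModels.Site
2))))) → Literature.Probability.LatticeModels.Site 2 → Prop := fun ω v => Xor (v 0 ∈ ω.1) (Xor (v 1
∈ ω.2.1) (Odd ((Finset.filter (fun f : ℤ × ℤ => par ω ![f.1, f.2]) (Finset.Ico (min 0 (v 0)) (max 0
(v 0)) ×ˢ Finset.Ico (min 0 (v 1)) (max 0 (v 1)))).card))); let anti : (Set ℤ × (Set ℤ × (Set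
(Literature.Probability.LatticeModels.Site 2) × (Set (Literature.Probability.LatticeModels.Site 2) ×
Set (Literature.Probability.LatticeModels.Site 2))))) → Literature.Probability.LatticeModels.Site 2
→ Prop := fun ω f => f 0 ∉ (Set.univ : Set ℤ) ∨ f ∈ ω.2.2.2.2; let edges : (Set ℤ × (Set ℤ × (Set
(Literature.Probability.LatticeModels.Site 2) × (Set (Literature.Probability.LatticeModels.Site 2) ×
Set (Literature.Probability.LatticeModels.Site 2))))) →
Literature.Probability.Percolation.BondConfig (Literature.Probability.LatticeModels.Site 2) := fun ω
=> {e | ∃ u v, e = s(u, v) ∧ blk ω u ∧ blk ω v ∧ (v = u + ![1, 0] ∨ v = u + ![0, 1] ∨ (v = u + ![1,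
1] ∧ ¬ anti ω u) ∨ (v = u + ![1, -1] ∧ anti ω (u + ![0, -1])))}; fun δ : ℝ => μ.real {ω | edges ω ∈
Literature.Probability.Percolation.embDomainCrossing (fun v :
Literature.Probability.LatticeModels.Site 2 => ((v 0 : ℝ) : ℂ) + ((v 1 : ℝ) : ℂ) * Complex.I)
R.carrier δ (R.arc 0) (R.arc 2)}) Literature.Probability.RandomPlanarGeometry.cardyFunction) ∧ (∀ R
: Literature.Probability.RandomPlanarGeometry.ConformalRectangle, Filter.Tendsto (fun δ : ℝ => (let
μ := (Literature.Probability.Percolation.sitePercolation ℤ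
Literature.Probability.Percolation.half).prod ((Literature.Probability.Percolation.sitePercolation ℤ
Literature.Probability.Percolation.half).prod ((Literature.Probability.Percolation.sitePercolation
(Literature.Probability.LatticeModels.Site 2) (Set.projIcc (0:ℝ) 1 zero_le_one (2 * Real.sqrt 3 -
3))).prod ((Literature.Probability.Percolation.sitePercolation
(Literature.Probability.LatticeModels.Site 2) Literature.Probability.Percolation.half).prod
(Literature.Probability.Percolation.sitePercolation (Literature.Probability.LatticeModels.Site 2)
Literature.Probability.Percolation.half)))); let par : (Set ℤ × (Set ℤ × (Set
(Literature.Probability.LatticeModels.Site 2) × (Set (Literature.Probability.LatticeModels.Site 2) ×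
Set (Literature.Probability.LatticeModels.Site 2))))) → Literature.Probability.LatticeModels.Site 2
→ Prop := fun ω f => (f 0 ∈ (Set.univ : Set ℤ) ∧ f ∈ ω.2.2.1) ∨ (f 0 ∉ (Set.univ : Set ℤ) ∧ f ∈
ω.2.2.2.1); let blk : (Set ℤ × (Set ℤ × (Set (Literature.Probability.LatticeModels.Site 2) × (Set
(Literature.Probability.LatticeModels.Site 2) × Set (Literature.Probability.LatticeModels.Site
2))))) → Literature.Probability.LatticeModels.Site 2 → Prop := fun ω v => Xor (v 0 ∈ ω.1) (Xor (v 1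
∈ ω.2.1) (Odd ((Finset.filter (fun f : ℤ × ℤ => par ω ![f.1, f.2]) (Finset.Ico (min 0 (v 0)) (max 0
(v 0)) ×ˢ Finset.Ico (min 0 (v 1)) (max 0 (v 1)))).card))); let anti : (Set ℤ × (Set ℤ × (Set
(Literature.Probability.LatticeModels.Site 2) × (Set (Literature.Probability.LatticeModels.Site 2) ×
Set (Literature.Probability.LatticeModels.Site 2))))) → Literature.Probability.LatticeModels.Site 2
→ Prop := fun ω f => f 0 ∉ (Set.univ : Set ℤ) ∨ f ∈ ω.2.2.2.2; let edges : (Set ℤ × (Set ℤ × (Set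
(Literature.Probability.LatticeModels.Site 2) × (Set (Literature.Probability.LatticeModels.Site 2) ×
Set (Literature.Probability.LatticeModels.Site 2))))) →
Literature.Probability.Percolation.BondConfig (Literature.Probability.LatticeModels.Site 2) := fun ω
=> {e | ∃ u v, e = s(u, v) ∧ blk ω u ∧ blk ω v ∧ (v = u + ![1, 0] ∨ v = u + ![0, 1] ∨ (v = u + ![1,
1] ∧ ¬ anti ω u) ∨ (v = u + ![1, -1] ∧ anti ω (u + ![0, -1])))}; fun δ : ℝ => μ.real {ω | edges ω ∈
Literature.Probability.Percolation.embDomainCrossing (fun v :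
Literature.Probability.LatticeModels.Site 2 => ((v 0 : ℝ) : ℂ) + ((v 1 : ℝ) : ℂ) * Complex.I)
R.carrier δ (R.arc 0) (R.arc 2)}) δ - (Literature.Probability.Percolation.bondPercolation
(Literature.Probability.LatticeModels.zdGraph 2) Literature.Probability.Percolation.half).real
(Literature.Probability.Percolation.embDomainCrossing
Literature.Probability.LatticeModels.squareLatticeEmbedding.z R.carrier δ (R.arc 0) (R.arc 2)))
(nhdsWithin 0 (Set.Ioi 0)) (nhds 0))`

## Assembly
Pure limit algebra, proved sorry-free as `assembly_holds` in the folder's Sketch.lean: for each R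
and uniformizing datum, CardyIK gives
ik_δ → F(η), IKBondBridge gives ik_δ − crude_δ → 0, hence crude_δ = ik_δ − (ik_δ − crude_δ) → F(η)
(Tendsto.sub, sub_sub_cancel,
sub_zero), and DiscretisationBridge R turns crude Cardy into Cardy for bondDomainCrossingProb, i.e.
CardyFormulaZ2.

Rationale: WHY THIS LINE. Glazman–Manolescu (GlazmanManolescu2019 = arXiv:1708.00395, Thm 1, Prop. 3.1/4.2)
proved that for Nienhuis' n = 0 weights on the
rhombic half-plane H(Θ), Θ ∈ [π/3, 2π/3]^ℕ, boundary two-point functions do not depend on Θ, by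
sliding a Yang–Baxter rhombus down
pairs of columns and pushing unwanted columns to infinity; θ = π/3 is the honeycomb lattice. At n =
1 the same family, at the
λ = π/3 point of the Izergin–Korepin R-matrix (GarbaliNienhuis arXiv:1411.7020 §2.1; Nienhuis1990;
MorinDuchesneKlumperPearce
arXiv:2211.12379 §2.2), has θ = π/3 member = uniform honeycomb loops = Smirnov's site percolation on
𝕋 (Smirnov2001, tree theorem
smirnov_tendsto_triDomainCrossingProb_holds) and θ = π/2 member = a D₄-symmetric percolation model
on the cells of ℤ²; we checked
numerically that all 76 boundary pairings of the Glazman–Manolescu hexagon balance at n = 1 with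
loop corrections for the weights
t = u₁ = u₂ = √3/(2 sin θ), v = 1, w₁ = sin(2π/3−θ)/sin θ, w₂ = sin(θ−π/3)/sin θ (23
non-tautological identities = IKHexagonYangBaxter),
and that v = 1, w₁ + w₂ = 1 make the colour field an exactly solvable plaquette model, i.e. an
explicit image of i.i.d. bits, so
every item is typed now and sampled exactly (2:1 box crossings 0.1757/0.1857/0.1745 ± 0.006 at L =
64/128/256 vs Cardy 0.17615;
squares 0.5008). Imported: Yang–Baxter integrability as a probabilistic column-exchange (exactly
solvable models), the
Grimmett–Manolescu/DKKMO transport technology (arXiv:1105.5535, arXiv:1204.0505, arXiv:2012.11672,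
arXiv:2502.08394) for the bulk
step, Beffara's modulus rigidity (tree EmbeddingModulusUniqueness_holds) for pinning. What prior
routes do not do: CardyIsoradial
transports inside the bond-isoradial class with an OPEN anchor; CardyIKTransport (sibling, same
family) leaves the model untyped and
ranks Manolescu's bulk transport first — here the model is a closed term, the first deliverable is
an exact boundary law
(HalfPlaneCardyIK: Cardy for a ℤ²-based model on half-plane arcs), and the a-priori input everything
needs (RSW for the mixed family,
no FKG: the 4-body plaquette weight fails Holley) is rank 2. Negatives index (stmt-0772, SAW):
unrelated.

RANKED CRUXES. #2 IKMixedBoxCrossing (crux) — RSW for the mixed family: there is c > 0 such that for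
EVERY set S ⊆ ℤ of isotropic (θ = π/2) columns (the others honeycomb, θ = π/3), every n ≥ 1 and
every position, the 2n × n and n × 2n cell boxes are crossed the long way by a black path with
probability ≥ c (model written explicitly from i.i.d. bits: fair line/row bits, plaquette parities
Bernoulli(2√3−3) in S-columns and fair elsewhere, saddle coins fair in S-columns and anti-diagonal
forced elsewhere). Card item 'RSW for the dilute O(1) model'; the a-priori input of
BoundaryLawInvariance, CardyIK and of route CardyIKTransport's r2/r4. [difficulty: L] (why it might
fail: no FKG: the colour marginal ∝ t^(#odd plaquettes) is a ferromagnetic 4-body field failing the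
Holley lattice condition, so RSW gluing/Tassion-KST renormalisation has no positive association to
lean on (cf. random-cluster q<1, where RSW is open); uniformity over all S adds anisotropy.)
[arXiv:2011.04618, arXiv:1105.5535, arXiv:1204.0505, GlazmanManolescu2019, arXiv:2211.12379]
#3 BoundaryLawInvariance (crux) — Glazman–Manolescu Theorem 1 at n = 1: for every S ⊆ ℤ and all
integer boundary arcs [a,b], [c,d] (a ≤ b < c ≤ d) on the line k = 0, the probability that they are
joined by a black path inside the half-plane k ≥ 0 is the SAME for the S-mixed model as for S = ∅
(site percolation on 𝕋): exact equality. Mechanism: n = 1 hexagon identity ⇒ connectivity-resolved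
commutation of adjacent column transfer operators ⇒ block-exchange coupling preserving colours off
the middle line and connectivity across it; push IK columns to infinity (locality from
IKMixedBoxCrossing). Realises card ik-honeycomb-perron-teleport (a) in Glazman–Manolescu geometry.
[deps: IKMixedBoxCrossing, IKHexagonYangBaxter] [difficulty: M] (why it might fail: exactness needs
the CONNECTIVITY-resolved (diagram-algebra) form of column commutation, not only the colour-matrix
identity, plus infinite-volume locality in both directions uniform in S; a boundary K-matrix
subtlety (Yung–Batchelor) could spoil the free line k = 0.) [GlazmanManolescu2019, arXiv:1411.7020,
hep-th/9506074, arXiv:2211.12379, Nienhuis1990]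
#4 CardyIK (crux) — Cardy's formula for the isotropic n = 1 Izergin–Korepin percolation model on δℤ²
(explicit i.i.d.-bit construction, S = all columns) in EVERY conformal rectangle, crude embedded
crossing event with the square embedding of cells. First Cardy theorem for a ℤ²-based model; the
law-level route is BoundaryLawInvariance + IKMixedBoxCrossing + a Manolescu-type bulk transport up
to a linear map along the column migration + D₄/modulus rigidity (route CardyIKTransport's
AnchorByRigidity). Card Y1. [deps: IKMixedBoxCrossing, BoundaryLawInvariance] [difficulty: XL] (why
it might fail: bulk transport must track macroscopic loops through ≍δ⁻² line resamplings that are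
non-local along the line; Manolescu's nail/IIC/LLN machinery (arXiv:2502.08394 §5.3) rests on FKG
and quasi-multiplicativity, unknown here; boundary data + RSW alone do not imply conformal
invariance.) [arXiv:2502.08394, arXiv:2012.11672, GlazmanManolescu2019, Smirnov2001,
arXiv:0708.3908]
#5 IKBondBridge (crux) — the crude crossing probabilities of the isotropic IK model and of bond
percolation on ℤ² at p = ½ (same embDomainCrossing recipe, squareLatticeEmbedding) differ by o(1) as
δ → 0⁺, for every conformal rectangle. Card Y2 (dense/dilute O(1) on one lattice); in the explicit
construction bond-ℤ² is the parity-density-0 end (colour = A_k ⊕ B_j, walls = renewal grid) and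
IK(π/2) the density 2√3−3 point of one exactly self-dual, D₄-symmetric one-parameter family
(corner-fugacity line b = ½). [deps: CardyIK] [difficulty: open-problem] (why it might fail:
one-lattice universality of conjunct calibre: each parity defect is a dislocation (two half-infinite
tracks), density 0 is a singular end, no monotone coupling in the density (XOR only moves toward ½),
and the Russo remainder is the >3/4-rate wall of CoveringLatticeShift-type interpolations.)
[arXiv:0708.3908, arXiv:1008.1378, arXiv:2012.11672, GlazmanManolescu2019, Nienhuis1990]
#9 IKHexagonYangBaxter (support) — the n = 1 Yang–Baxter hexagon identities in Glazman–Manolescu's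
geometry (their Prop. 3.1 table, tree YangBaxterSAWYBE.lean, with loop-weight-1 corrections around
the interior vertex): with t(θ) = √3/(2 sin θ), v = 1, w₁(θ) = sin(2π/3−θ)/sin θ, w₂(θ) =
sin(θ−π/3)/sin θ and δ = θ₂ − θ₁, the 23 non-tautological pairing identities (E0E1, E0E2, E1E4,
E2E3, E3E5, E4E5, E0E1·E2E3, E0E2·E1E3, E0E1·E2E4, E0E2·E1E4, E0E1·E2E5, E0E2·E1E5, E0E1·E3E4,
E0E3·E1E4, E0E1·E4E5, E0E5·E1E4, E0E2·E3E4, E0E4·E2E3, E0E2·E3E5, E1E4·E3E5, E2E3·E4E5,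
E0E1·E2E3·E4E5, E0E2·E1E4·E3E5, in this order) hold for π/3 ≤ θ₁ < θ₂ ≤ 2π/3. Checked numerically to
1e-8 (scratch/ybe_n1_loops.py); pure trigonometry. [difficulty: provable-now] [GlazmanManolescu2019,
Glazman2015WeightedSAW, Nienhuis1990, arXiv:1411.7020]
#9 HalfPlaneCardyT (support) — Smirnov's theorem read on half-plane boundary arcs for the S = ∅
member (i.i.d. fair colours of ℤ² with edges (1,0), (0,1), (1,−1) = site percolation on 𝕋 =
triGraph): P[δ-scaled arcs [a,b] ↔ [c,d] on the line k = 0 inside k ≥ 0] →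
cardyFunction(crossRatio(a,b,c,d)). From hasCrossingLimit_triDomainCrossingProb (tree) by half-discs
+ RSW truncation + identification of the construction with triSitePercolation. [difficulty: M]
[Smirnov2001, BollobasRiordan2006, tree:smirnov_tendsto_triDomainCrossingProb_holds]
#9 HalfPlaneCardyIK (support) — the first Cardy theorem for a ℤ²-based model: half-plane
boundary-arc crossing probabilities of the isotropic IK model converge to Cardy's formula. Immediate
from BoundaryLawInvariance (S = univ vs ∅, integer arcs ⌈a/δ⌉…) and HalfPlaneCardyT. [difficulty: S]
[GlazmanManolescu2019, Smirnov2001]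
#9 DiscretisationBridge (support) — on ℤ², Cardy for the crude embedded crossing event implies Cardy
for G02's bondDomainCrossingProb, per conformal rectangle — verbatim route CardyIsoradial's
stmt-CriticalPhenomena-0787 (shared item); route CardyIKTransport's CrudeToCanonical (stmt-4968) is
its global form. [difficulty: M] [BollobasRiordan2006, arXiv:1204.0505, stmt-CriticalPhenomena-0787]

TWO-LAYER PLAN. BoundaryLawInvariance ⇐ ColumnExchangeCoupling (finite cylinders:
connectivity-resolved block exchange from IKHexagonYangBaxter, provable)
→ PushToInfinity (locality from IKMixedBoxCrossing) → BoundaryLawInvariance. CardyIK ⇐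
IKLinearTransport (limits of IK(π/2) = K-image of
site-T limits, K real-linear; shared in intent with route CardyIKTransport r2) → AnchorByRigidity
(CardyIKTransport stmt-4969) → CardyIK.
IKMixedBoxCrossing ⇐ isotropic S = univ case (squares are exactly ½ by D₄ + self-duality;
rectangles) → transport of box crossings
through block exchanges à la Grimmett–Manolescu 2013 → uniform S. IKBondBridge ⇐ CornerLineDescent
(CardyIKTransport r3 /
card corner-fugacity-plane F4) → RenewalGridHarmless (stmt-4967).

KILL CRITERIA. A finite-size DISAGREEMENT of half-cylinder (periodic) boundary-arc connection
probabilities between IK(π/2) and site-𝕋 beyond rounding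
(exact enumeration, width ≤ 10) refutes the connectivity-resolved commutation and closes the route
`refuted:BoundaryLawInvariance`
(and retires the Yang–Baxter mechanism for all IK cards). ¬IKMixedBoxCrossing for some S forces a
pivot to cylinder-only statements
(HalfPlaneCardyIK via periodic strips) and kills CardyIK's transport. ¬CardyIK (isotropic IK limit
not conformally invariant) closes
this route and CardyIKTransport alike. ¬IKBondBridge leaves CardyIK/HalfPlaneCardyIK as the
deliverable and closes the route
`refuted:IKBondBridge` for the conjunct (hand CardyIK to any same-lattice universality route).
CardyFormulaZ2 proved elsewhere moots it.

NOT DECOMPOSED YET. The connectivity-resolved column commutation as a finite-dimensional statement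
(dilute link-pattern / diagram algebra on a ring), the
cylinder-to-plane locality lemmas, the quasi-1D extinction on cylinders (elementary: a line is all
white with probability ≥ ½p^L), the
identification of the S = ∅ construction with triSitePercolation, the bulk transport lemmas (arm
separation, nails) for the explicit
model, and every constant — all layer-2 children once IKMixedBoxCrossing or BoundaryLawInvariance
closes. No third layer.

CHEAPEST FALSIFIER. (i) Exact enumeration at width L ≤ 8 (or the MC already run): boundary-arc
connection probabilities on the half-plane/cylinder for
S = all-IK, S = ∅ (site-𝕋), S alternating must coincide — run here on the truncated half-plane
[0,48)×[−48,48), arcs [−12,−4]↔[4,12],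
N = 4000 each: 0.3555 / 0.3480 / 0.3558 / 0.3515 ± 0.0076, consistent with equality
(scratch/bli_mc.log). (ii) IK(π/2) rectangle
crossings vs Cardy: 2:1 boxes 0.1757 / 0.1857 / 0.1745 ± 0.006 at L = 64/128/256 (Cardy 0.17615),
squares 0.5008 / 0.5020
(scratch/ik_mc2.log) — passed. (iii) lean: the 23 identities of IKHexagonYangBaxter by `field_simp`
+ trig expansion; a failure there
kills everything at once.

NUMBERS. p_IK = t/(1+t) = 2√3 − 3 = 0.46410 (t = √3/2 corner fugacity at θ = π/2); weights at π/2: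
(1, √3/2, 1, ½, ½); at π/3: (1,1,1,1,0).
Cardy: 2:1 hard crossing 0.17615; F(¼) ≈ 0.374 (truncated-box MC 0.35). Plaquette 4-point bias
E[(−1)^(4 corners)] = (1−t)/(1+t) =
0.0718 at π/2, all 2- and 3-point colour correlations vanish. Items at open: 9 (4 cruxes, 4 support,
1 assembly).

DEFINITION REQUESTS. D1 (definition, Literature/Probability/LatticeModels):
`NienhuisPercolationFamily` — the n = 1 Izergin–Korepin/Nienhuis cell-percolation
measure on the Glazman–Manolescu tiling H(Θ), Θ : ℤ → [π/3, 2π/3] (cells = tiling vertices, colours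
with corner fugacity
√3/(2 sin θ_k) per column, saddle coins of bias sin(2π/3−θ_k)/sin θ_k), its isoradial embedding and
crossing probabilities
`ikDomainCrossingProb Θ R δ`, with the identification lemma: for Θ ∈ {π/3, π/2}^ℤ it is the
push-forward of the i.i.d.-bit construction
used verbatim in this route's items (so signatures can later be shortened by `rfl`-level rewriting).
D2 (cite fact, crit-ising trunk):
Nienhuis 1990 / Glazman 2015 general-n Yang–Baxter weights, of which IKHexagonYangBaxter is the n =
1, λ = π/3 instance.

Novelty: Searches (2026-08-15): `lit read arxiv:1708.00395 --grep loop|O(n)` (p. 9: "Equivalent relations may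
be obtained for any model with
loop-weight between 0 and 2 … we only treat here the case of null loop-weight"); `lit search
--hybrid "square lattice O(n) loop model
Nienhuis integrable weights honeycomb limit Yang-Baxter percolation"` (8 book hits, none relevant);
`lit search` FTS x3 and `lit galaxy
search "Izergin-Korepin percolation" --star all`, `"dilute loop model percolation square lattice
Yang-Baxter honeycomb limit"`, `"Cardy
formula square lattice vertex model" --star pdf` (searchd connection reset / galaxyd saturated at
11:40Z–12:10Z, 0 rows — to be re-run by
the refuter); tree: YangBaxterSAW*.lean (n = 0 only), NienhuisWeightsExcludeVertexSAW (n = 0), all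
125 cards of the sub (3 IK siblings),
the 19 route files (CardyIKTransport read in full).
Nearest prior art found: GlazmanManolescu2019 (arXiv:1708.00395) Thm 1 / Prop. 3.1–4.2 — the
column-migration engine, n = 0, no
crossing probabilities; arXiv:2211.12379 and arXiv:1411.7020 — the n = 1 IK tiles and 'related to
site percolation', no Cardy; route
CardyIKTransport (2026-08-15) — same family, block-resampling + Manolescu transport, untyped model.
Delta: the n = 1 Glazman–Manolescu migration with its verified loop-corrected hexagon identity, the
observation that v = 1 and
w₁ + w₂ = 1 make the whole {π/3, π/2} family an explicit image of i.i.d. bits (typed, exactly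
samplable), and the resulting exact
boundary-law prog  [refs: 1708.00395, 2211.12379, 1411.7020, arxiv:1708.00395, GlazmanManolescu2019]

Barriers (technique_class: yang-baxter-transport, boundary-law, rsw-no-fkg): - technique_class: yang-baxter-transport, boundary-law, rsw-no-fkg
- Literature.Barriers.CriticalPhenomena.EmbeddingModulusUniqueness: respected and used —
BoundaryLawInvariance compares only collinear boundary 4-point laws, which are blind to the
vertical-line-preserving linear maps that distinguish the mixed models' bulk limits (evasion (ii):
the transport sees the embedding); CardyIK's bulk step outputs 'up to a linear map' exactly as the
barrier predicts and is pinned by the exact D₄ symmetry of IK(π/2) (evasion (i)), via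
CardyIKTransport's AnchorByRigidity / the tree's EmbeddingModulusUniqueness_holds.
- Literature.Barriers.CriticalPhenomena.SmirnovTriangularOnly: not transplanted — Smirnov's theorem
enters only at S = ∅ (HalfPlaneCardyT), where the faces ARE equilateral; ℤ² receives the result
through an identity of boundary laws.
- Literature.Barriers.CriticalPhenomena.CoveringLatticeShift: bears on IKBondBridge only; the
density interpolation is on ONE lattice with exact self-duality and D₄ at every point (no shift
pairing q ↦ 1−q), but it does not evade the generic residue: the bet is that an exact-Cardy,
same-symmetry anchor on ℤ²'s own cells isolates the universality rate in its purest form; conceded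
open-problem size.
- Literature.Barriers.CriticalPhenomena.NienhuisWeightsExcludeVertexSAW: the n = 1 analogue of its
moral applies and is accepted — the integrable orbit lands on a cell/face model of ℤ², never on
bond-ℤ² itself; IKBondBridge is exactly that price, fil

History (route lifecycle, newest last):
- 2026-08-26T07:51:24Z · DORMANT — reconciler: no traction for 8.4 d (last activity item-evidence-added at 2026-08-17T21:54:40Z); parked, not closed — `ledger route dormant route-CriticalPhenomen (operator:999:2245620)

sub-problem: CardyFormulaZ2 · status: dormant · opened planner-plancard-CriticalPhenomena-CardyFormu-63696348-0 2026-08-15T11:43:27Z · rev 3 · ledger route-CriticalPhenomena-CardyDiluteOrbit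
GENERATED by the gate from the ledger (D-0016/17). Provers cite these decls: `theorem foo : Summit.CriticalPhenomena.CardyFormulaZ2.Theses.CardyDiluteOrbit.<Decl> := …` in Summits/CriticalPhenomena/CardyFormulaZ2/Theorems/<Name>.lean.
-/

namespace Summit.CriticalPhenomena.CardyFormulaZ2.Theses.CardyDiluteOrbit

open scoped BigOperators Topology Manifold Classical MeasureTheory ProbabilityTheory Matrix InnerProductSpace ComplexConjugate ContinuousMap
open Filter Set Function TopologicalSpace MeasureTheory

attribute [summit_statement] _root_.CardyFormulaZ2

/-- item stmt-CriticalPhenomena-5911 · crux · rank 2 · open · by planner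
why it might fail: No positive association: on one face Cov(1[σ1∨σ2],1[σ3∧σ4]) = −ρ/16 < 0, ρ=(1−t)/(1+t), so squares=½ does not glue into rectangles (RSW/KST need FKG); RSW-without-FKG is only perturbative (Beffara–Gayet); GM-type transport in S has no coupling: the π/6 exchange rhombus has w₂=−1.
sources: arXiv:1710.10644, arXiv:2011.04618, arXiv:2001.11977, arXiv:1204.0505, GlazmanManolescu2019
[crux] RSW for the mixed family: there is c > 0 such that for EVERY set S ⊆ ℤ of isotropic (θ = π/2)
columns (the others honeycomb, θ = π/3), every n ≥ 1 and every position, the 2n × n and n × 2n cell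
boxes are crossed the long way by a black path with probability ≥ c (model written explicitly from
i.i.d. bits: fair line/row bits, plaquette parities Bernoulli(2√3−3) in S-columns and fair
elsewhere, saddle coins fair in S-columns and anti-diagonal forced elsewhere). Card item 'RSW for
the dilute O(1) model'; the a-priori input of BoundaryLawInvariance, CardyIK and of route
CardyIKTransport's r2/r4. [difficulty: L] -/
@[route_item "route-CriticalPhenomena-CardyDiluteOrbit", crux]
def IKMixedBoxCrossing : Prop :=
  ∃ c : ℝ, 0 < c ∧ ∀ S : Set ℤ, ∀ n : ℕ, 1 ≤ n → ∀ a b : ℤ, let μ := (Literature.Probability.Percolation.sitePercolation ℤ Literature.Probability.Percolation.half).prod ((Literature.Probability.Percolation.sitePercolation ℤ Literature.Probability.Percolation.half).prod ((Literature.Probability.Percolation.sitePercolation (Literature.Probability.LatticeModels.Site 2) (Set.projIcc (0:ℝ) 1 zero_le_one (2 * Real.sqrt 3 - 3))).prod ((Literature.Probability.Percolation.sitePercolation (Literature.Probability.LatticeModels.Site 2) Literature.Probability.Percolation.half).prod (Literature.Probability.Percolation.sitePercolation (Literature.Probability.LatticeModels.Site 2) Literature.Probability.Percolation.half)))); let par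 : (Set ℤ × (Set ℤ × (Set (Literature.Probability.LatticeModels.Site 2) × (Set (Literature.Probability.LatticeModels.Site 2) × Set (Literature.Probability.LatticeModels.Site 2))))) → Literature.Probability.LatticeModels.Site 2 → Prop := fun ω f => (f 0 ∈ S ∧ f ∈ ω.2.2.1) ∨ (f 0 ∉ S ∧ f ∈ ω.2.2.2.1); let blk : (Set ℤ × (Set ℤ × (Set (Literature.Probability.LatticeModels.Site 2) × (Set (Literature.Probability.LatticeModels.Site 2) × Set (Literature.Probability.LatticeModels.Site 2))))) → Literature.Probability.LatticeModels.Site 2 → Prop := fun ω v => Xor (v 0 ∈ ω.1) (Xor (v 1 ∈ ω.2.1) (Odd ((Finset.filter (fun f : ℤ × ℤ => par ω ![f.1, f.2]) (Finset.Ico (min 0 (v 0)) (max 0 (v 0)) ×ˢ Finset.Ico (min 0 (v 1)) (max 0 (v 1)))).card))); let anti : (Set ℤ × (Set ℤ × (Set (Literature.Probability.LatticeModels.Site 2) × (Set (Literature.Probability.LatticeModels.Site 2) × Set (Literature.Probability.LatticeModels.Site 2))))) → Literature.Probability.LatticeModels.Site 2 → Prop := fun ω f => f 0 ∉ S ∨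 f ∈ ω.2.2.2.2; let edges : (Set ℤ × (Set ℤ × (Set (Literature.Probability.LatticeModels.Site 2) × (Set (Literature.Probability.LatticeModels.Site 2) × Set (Literature.Probability.LatticeModels.Site 2))))) → Literature.Probability.Percolation.BondConfig (Literature.Probability.LatticeModels.Site 2) := fun ω => {e | ∃ u v, e = s(u, v) ∧ blk ω u ∧ blk ω v ∧ (v = u + ![1, 0] ∨ v = u + ![0, 1] ∨ (v = u + ![1, 1] ∧ ¬ anti ω u) ∨ (v = u + ![1, -1] ∧ anti ω (u + ![0, -1])))}; c ≤ μ.real {ω | edges ω ∈ Literature.Probability.Percolation.openCrossing {v | a ≤ v 0 ∧ v 0 < a + 2 * n ∧ b ≤ v 1 ∧ v 1 < b + n} {v | v 0 = a ∧ b ≤ v 1 ∧ v 1 < b + n} {v | v 0 = a + 2 * n - 1 ∧ b ≤ v 1 ∧ v 1 < b + n}} ∧ c ≤ μ.real {ω | edges ω ∈ Literature.Probability.Percolation.openCrossing {v | a ≤ v 0 ∧ v 0 < a + n ∧ b ≤ v 1 ∧ v 1 < b + 2 * n} {v | v 1 = b ∧ a ≤ v 0 ∧ v 0 < a + n} {v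 | v 1 = b + 2 * n - 1 ∧ a ≤ v 0 ∧ v 0 < a + n}}

/-- item stmt-CriticalPhenomena-5912 · crux · rank 3 · open · by planner
why it might fail: Column-ORDER exchange in strips is exact (n=1 YBE checked by enumeration; GM2019 Prop 4.2), but GM change ANGLES by SAW-only monotonicity (Lem 4.3)+parafermionic sum rule; at n=1, P S = P ∅ needs sup_S P_S(arcs joined, not within width K)→0: uniform one-arm decay, no FKG; exchange signed, w₂(π/6)=−1
sources: GlazmanManolescu2019, arXiv:1204.0505, arXiv:2211.12379, arXiv:2001.11977, Nienhuis1990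
[crux] Glazman–Manolescu Theorem 1 at n = 1: for every S ⊆ ℤ and all integer boundary arcs [a,b],
[c,d] (a ≤ b < c ≤ d) on the line k = 0, the probability that they are joined by a black path inside
the half-plane k ≥ 0 is the SAME for the S-mixed model as for S = ∅ (site percolation on 𝕋): exact
equality. Mechanism: n = 1 hexagon identity ⇒ connectivity-resolved commutation of adjacent column
transfer operators ⇒ block-exchange coupling preserving colours off the middle line and connectivity
across it; push IK columns to infinity (locality from IKMixedBoxCrossing). Realises card
ik-honeycomb-perron-teleport (a) in Glazman–Manolescu geometry. [deps: IKMixedBoxCrossing,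
IKHexagonYangBaxter] [difficulty: M] -/
@[route_item "route-CriticalPhenomena-CardyDiluteOrbit", crux]
def BoundaryLawInvariance : Prop :=
  ∀ a b c d : ℤ, a ≤ b → b < c → c ≤ d → let P : Set ℤ → ℝ := fun S => let μ := (Literature.Probability.Percolation.sitePercolation ℤ Literature.Probability.Percolation.half).prod ((Literature.Probability.Percolation.sitePercolation ℤ Literature.Probability.Percolation.half).prod ((Literature.Probability.Percolation.sitePercolation (Literature.Probability.LatticeModels.Site 2) (Set.projIcc (0:ℝ) 1 zero_le_one (2 * Real.sqrt 3 - 3))).prod ((Literature.Probability.Percolation.sitePercolation (Literature.Probability.LatticeModels.Site 2) Literature.Probability.Percolation.half).prod (Literature.Probability.Percolation.sitePercolation (Literature.Probability.LatticeModels.Site 2) Literature.Probability.Percolation.half)))); let par : (Set ℤ × (Set ℤ × (Set (Literature.Probability.LatticeModels.Site 2) × (Set (Literature.Probability.LatticeModels.Site 2) × Set (Literature.Probability.LatticeModels.Site 2))))) → Literature.Probability.LatticeModels.Site 2 → Prop := fun ω f => (f 0 ∈ S ∧ f ∈ ω.2.2.1) ∨ (f 0 ∉ S ∧ f ∈ ω.2.2.2.1);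 let blk : (Set ℤ × (Set ℤ × (Set (Literature.Probability.LatticeModels.Site 2) × (Set (Literature.Probability.LatticeModels.Site 2) × Set (Literature.Probability.LatticeModels.Site 2))))) → Literature.Probability.LatticeModels.Site 2 → Prop := fun ω v => Xor (v 0 ∈ ω.1) (Xor (v 1 ∈ ω.2.1) (Odd ((Finset.filter (fun f : ℤ × ℤ => par ω ![f.1, f.2]) (Finset.Ico (min 0 (v 0)) (max 0 (v 0)) ×ˢ Finset.Ico (min 0 (v 1)) (max 0 (v 1)))).card))); let anti : (Set ℤ × (Set ℤ × (Set (Literature.Probability.LatticeModels.Site 2) × (Set (Literature.Probability.LatticeModels.Site 2) × Set (Literature.Probability.LatticeModels.Site 2))))) → Literature.Probability.LatticeModels.Site 2 → Prop := fun ω f => f 0 ∉ S ∨ f ∈ ω.2.2.2.2; let edges : (Set ℤ × (Set ℤ × (Set (Literature.Probability.LatticeModels.Site 2) × (Set (Literature.Probability.LatticeModels.Site 2) × Set (Literature.Probability.LatticeModels.Site 2))))) → Literature.Probability.Percolation.BondConfig (Literature.Probability.LatticeModels.Site 2) := fun ω => {e | ∃ u v, e = s(u, v) ∧ blk ω u ∧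 blk ω v ∧ (v = u + ![1, 0] ∨ v = u + ![0, 1] ∨ (v = u + ![1, 1] ∧ ¬ anti ω u) ∨ (v = u + ![1, -1] ∧ anti ω (u + ![0, -1])))}; μ.real {ω | edges ω ∈ Literature.Probability.Percolation.openCrossing {v | 0 ≤ v 0} {v | v 0 = 0 ∧ a ≤ v 1 ∧ v 1 ≤ b} {v | v 0 = 0 ∧ c ≤ v 1 ∧ v 1 ≤ d}}; ∀ S : Set ℤ, P S = P ∅

/-- item stmt-CriticalPhenomena-5913 · crux · rank 4 · open · by planner
why it might fail: Conformal invariance for a new ℤ²-cell model: exact boundary laws + RSW do not give bulk conformal invariance; Manolescu/DKKMO transport needs measure-preserving exchange couplings, FKG, quasi-multiplicativity, none available (π/6 exchange rhombus signed, no FKG); no n=1 square-lattice observable.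
sources: arXiv:2502.08394, arXiv:2012.11672, Smirnov2001, arXiv:0708.3908, GlazmanManolescu2019
[crux] Cardy's formula for the isotropic n = 1 Izergin–Korepin percolation model on δℤ² (explicit
i.i.d.-bit construction, S = all columns) in EVERY conformal rectangle, crude embedded crossing
event with the square embedding of cells. First Cardy theorem for a ℤ²-based model; the law-level
route is BoundaryLawInvariance + IKMixedBoxCrossing + a Manolescu-type bulk transport up to a linear
map along the column migration + D₄/modulus rigidity (route CardyIKTransport's AnchorByRigidity).
Card Y1. [deps: IKMixedBoxCrossing, BoundaryLawInvariance] [difficulty: XL] -/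
@[route_item "route-CriticalPhenomena-CardyDiluteOrbit", crux]
def CardyIK : Prop :=
  ∀ R : Literature.Probability.RandomPlanarGeometry.ConformalRectangle, R.HasCrossingLimit (let μ := (Literature.Probability.Percolation.sitePercolation ℤ Literature.Probability.Percolation.half).prod ((Literature.Probability.Percolation.sitePercolation ℤ Literature.Probability.Percolation.half).prod ((Literature.Probability.Percolation.sitePercolation (Literature.Probability.LatticeModels.Site 2) (Set.projIcc (0:ℝ) 1 zero_le_one (2 * Real.sqrt 3 - 3))).prod ((Literature.Probability.Percolation.sitePercolation (Literature.Probability.LatticeModels.Site 2) Literature.Probability.Percolation.half).prod (Literature.Probability.Percolation.sitePercolation (Literature.Probability.LatticeModels.Site 2) Literature.Probability.Percolation.half)))); let par : (Set ℤ × (Set ℤ × (Set (Literature.Probability.LatticeModels.Site 2) × (Set (Literature.Probability.LatticeModels.Site 2) × Set (Literature.Probability.LatticeModels.Site 2))))) → Literature.Probability.LatticeModels.Site 2 → Prop := fun ω f => (f 0 ∈ (Set.univ : Set ℤ) ∧ f ∈ ω.2.2.1) ∨ (f 0 ∉ (Set.univ : Set ℤ) ∧ f ∈ ω.2.2.2.1);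 let blk : (Set ℤ × (Set ℤ × (Set (Literature.Probability.LatticeModels.Site 2) × (Set (Literature.Probability.LatticeModels.Site 2) × Set (Literature.Probability.LatticeModels.Site 2))))) → Literature.Probability.LatticeModels.Site 2 → Prop := fun ω v => Xor (v 0 ∈ ω.1) (Xor (v 1 ∈ ω.2.1) (Odd ((Finset.filter (fun f : ℤ × ℤ => par ω ![f.1, f.2]) (Finset.Ico (min 0 (v 0)) (max 0 (v 0)) ×ˢ Finset.Ico (min 0 (v 1)) (max 0 (v 1)))).card))); let anti : (Set ℤ × (Set ℤ × (Set (Literature.Probability.LatticeModels.Site 2) × (Set (Literature.Probability.LatticeModels.Site 2) × Set (Literature.Probability.LatticeModels.Site 2))))) → Literature.Probability.LatticeModels.Site 2 → Prop := fun ω f => f 0 ∉ (Set.univ : Set ℤ) ∨ f ∈ ω.2.2.2.2; let edges : (Set ℤ × (Set ℤ × (Set (Literature.Probability.LatticeModels.Site 2) × (Set (Literature.Probability.LatticeModels.Site 2) × Set (Literature.Probability.LatticeModels.Site 2))))) → Literature.Probability.Percolation.BondConfig (Literature.Probability.LatticeModels.Site 2) := fun ω => {e | ∃ u v, e = s(u,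 v) ∧ blk ω u ∧ blk ω v ∧ (v = u + ![1, 0] ∨ v = u + ![0, 1] ∨ (v = u + ![1, 1] ∧ ¬ anti ω u) ∨ (v = u + ![1, -1] ∧ anti ω (u + ![0, -1])))}; fun δ : ℝ => μ.real {ω | edges ω ∈ Literature.Probability.Percolation.embDomainCrossing (fun v : Literature.Probability.LatticeModels.Site 2 => ((v 0 : ℝ) : ℂ) + ((v 1 : ℝ) : ℂ) * Complex.I) R.carrier δ (R.arc 0) (R.arc 2)}) Literature.Probability.RandomPlanarGeometry.cardyFunction

/-- item stmt-CriticalPhenomena-5914 · crux · rank 5 · open · by planner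
why it might fail: One-lattice universality, correlated-site/random-diagonal model vs bond-ℤ² at p=½: no monotone or measure-preserving interpolation known (XOR-ing plaquette parities only moves density toward ½; one parity defect is a non-local dislocation); GM universality covers only isoradial BOND models; open.
sources: arXiv:0708.3908, arXiv:1204.0505, arXiv:1008.1378, arXiv:2012.11672, Nienhuis1990
[crux] the crude crossing probabilities of the isotropic IK model and of bond percolation on ℤ² at p
= ½ (same embDomainCrossing recipe, squareLatticeEmbedding) differ by o(1) as δ → 0⁺, for every
conformal rectangle. Card Y2 (dense/dilute O(1) on one lattice); in the explicit construction
bond-ℤ² is the parity-density-0 end (colour = A_k ⊕ B_j, walls = renewal grid) and IK(π/2) the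
density 2√3−3 point of one exactly self-dual, D₄-symmetric one-parameter family (corner-fugacity
line b = ½). [deps: CardyIK] [difficulty: open-problem] -/
@[route_item "route-CriticalPhenomena-CardyDiluteOrbit", crux]
def IKBondBridge : Prop :=
  ∀ R : Literature.Probability.RandomPlanarGeometry.ConformalRectangle, Filter.Tendsto (fun δ : ℝ => (let μ := (Literature.Probability.Percolation.sitePercolation ℤ Literature.Probability.Percolation.half).prod ((Literature.Probability.Percolation.sitePercolation ℤ Literature.Probability.Percolation.half).prod ((Literature.Probability.Percolation.sitePercolation (Literature.Probability.LatticeModels.Site 2) (Set.projIcc (0:ℝ) 1 zero_le_one (2 * Real.sqrt 3 - 3))).prod ((Literature.Probability.Percolation.sitePercolation (Literature.Probability.LatticeModels.Site 2) Literature.Probability.Percolation.half).prod (Literature.Probability.Percolation.sitePercolation (Literature.Probability.LatticeModels.Site 2) Literature.Probability.Percolation.half)))); let par : (Set ℤ × (Set ℤ × (Set (Literature.Probability.LatticeModels.Site 2) × (Set (Literature.Probability.LatticeModels.Site 2) × Set (Literature.Probability.LatticeModels.Site 2))))) → Literature.Probability.LatticeModels.Site 2 → Prop := fun ω f => (f 0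 ∈ (Set.univ : Set ℤ) ∧ f ∈ ω.2.2.1) ∨ (f 0 ∉ (Set.univ : Set ℤ) ∧ f ∈ ω.2.2.2.1); let blk : (Set ℤ × (Set ℤ × (Set (Literature.Probability.LatticeModels.Site 2) × (Set (Literature.Probability.LatticeModels.Site 2) × Set (Literature.Probability.LatticeModels.Site 2))))) → Literature.Probability.LatticeModels.Site 2 → Prop := fun ω v => Xor (v 0 ∈ ω.1) (Xor (v 1 ∈ ω.2.1) (Odd ((Finset.filter (fun f : ℤ × ℤ => par ω ![f.1, f.2]) (Finset.Ico (min 0 (v 0)) (max 0 (v 0)) ×ˢ Finset.Ico (min 0 (v 1)) (max 0 (v 1)))).card))); let anti : (Set ℤ × (Set ℤ × (Set (Literature.Probability.LatticeModels.Site 2) × (Set (Literature.Probability.LatticeModels.Site 2) × Set (Literature.Probability.LatticeModels.Site 2))))) → Literature.Probability.LatticeModels.Site 2 → Prop := fun ω f => f 0 ∉ (Set.univ : Set ℤ) ∨ f ∈ ω.2.2.2.2; let edges : (Set ℤ × (Set ℤ × (Set (Literature.Probability.LatticeModels.Site 2) × (Set (Literature.Probability.LatticeModels.Site 2) × Set (Literature.Probability.LatticeModels.Site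 2))))) → Literature.Probability.Percolation.BondConfig (Literature.Probability.LatticeModels.Site 2) := fun ω => {e | ∃ u v, e = s(u, v) ∧ blk ω u ∧ blk ω v ∧ (v = u + ![1, 0] ∨ v = u + ![0, 1] ∨ (v = u + ![1, 1] ∧ ¬ anti ω u) ∨ (v = u + ![1, -1] ∧ anti ω (u + ![0, -1])))}; fun δ : ℝ => μ.real {ω | edges ω ∈ Literature.Probability.Percolation.embDomainCrossing (fun v : Literature.Probability.LatticeModels.Site 2 => ((v 0 : ℝ) : ℂ) + ((v 1 : ℝ) : ℂ) * Complex.I) R.carrier δ (R.arc 0) (R.arc 2)}) δ - (Literature.Probability.Percolation.bondPercolation (Literature.Probability.LatticeModels.zdGraph 2) Literature.Probability.Percolation.half).real (Literature.Probability.Percolation.embDomainCrossing Literature.Probability.LatticeModels.squareLatticeEmbedding.z R.carrier δ (R.arc 0) (R.arc 2))) (nhdsWithin 0 (Set.Ioi 0)) (nhds 0)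

/-- item stmt-CriticalPhenomena-0787 · support · rank 9 · closed · proved by Summit.CriticalPhenomena.CardyFormulaZ2.Cruxes.DiscretisationBridge.Birth.DiscretisationBridge_skeleton @ b5325d8714b8 (prover) · by planner
sources: BollobasRiordan2006, arXiv:1204.0505, stmt-CriticalPhenomena-0787
[crux] Discretisation bridge on Z^2: Cardy for the crude embedded crossing event (embDomainCrossing
squareLatticeEmbedding.z: open path with all vertices in Ω, endpoints within 2δ of the arcs (ab),
(cd)) under P_{1/2} implies Cardy for G02's bondDomainCrossingProb (largest component Ω_δ of Ω ∩
δZ^2, discrete arcs by distance comparison). Content: boundary RSW on Z^2 — crossings can be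
re-routed near ∂Ω at o(1) cost; the Literature notes neither statement formally implies the other
(CardyFormula module doc, flag (i)). -/
@[route_item "route-CriticalPhenomena-CardyDiluteOrbit", crux]
def DiscretisationBridge : Prop :=
  ∀ R : Literature.Probability.RandomPlanarGeometry.ConformalRectangle, R.HasCrossingLimit (fun δ ↦ (Literature.Probability.Percolation.bondPercolation (Literature.Probability.LatticeModels.zdGraph 2) Literature.Probability.Percolation.half).real (Literature.Probability.Percolation.embDomainCrossing Literature.Probability.LatticeModels.squareLatticeEmbedding.z R.carrier δ (R.arc 0) (R.arc 2))) Literature.Probability.RandomPlanarGeometry.cardyFunction → R.HasCrossingLimit (Literature.Probability.Percolation.bondDomainCrossingProb R) Literature.Probability.RandomPlanarGeometry.cardyFunction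

/-- `DiscretisationBridge` holds: proved by `Summit.CriticalPhenomena.CardyFormulaZ2.Cruxes.DiscretisationBridge.Birth.DiscretisationBridge_skeleton` @ b5325d8714b8. -/
theorem DiscretisationBridge_holds : DiscretisationBridge := _root_.Summit.CriticalPhenomena.CardyFormulaZ2.Cruxes.DiscretisationBridge.Birth.DiscretisationBridge_skeleton

/-- item stmt-CriticalPhenomena-5915 · support · rank 9 · open · by planner
sources: GlazmanManolescu2019, Glazman2015WeightedSAW, Nienhuis1990, arXiv:1411.7020
[support] the n = 1 Yang–Baxter hexagon identities in Glazman–Manolescu's geometry (their Prop. 3.1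
table, tree YangBaxterSAWYBE.lean, with loop-weight-1 corrections around the interior vertex): with
t(θ) = √3/(2 sin θ), v = 1, w₁(θ) = sin(2π/3−θ)/sin θ, w₂(θ) = sin(θ−π/3)/sin θ and δ = θ₂ − θ₁, the
23 non-tautological pairing identities (E0E1, E0E2, E1E4, E2E3, E3E5, E4E5, E0E1·E2E3, E0E2·E1E3,
E0E1·E2E4, E0E2·E1E4, E0E1·E2E5, E0E2·E1E5, E0E1·E3E4, E0E3·E1E4, E0E1·E4E5, E0E5·E1E4, E0E2·E3E4,
E0E4·E2E3, E0E2·E3E5, E1E4·E3E5, E2E3·E4E5, E0E1·E2E3·E4E5, E0E2·E1E4·E3E5, in this order) hold for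
π/3 ≤ θ₁ < θ₂ ≤ 2π/3. Checked numerically to 1e-8 (scratch/ybe_n1_loops.py); pure trigonometry.
[difficulty: provable-now] -/
@[route_item "route-CriticalPhenomena-CardyDiluteOrbit", crux]
def IKHexagonYangBaxter : Prop :=
  ∀ (t w₁ w₂ : ℝ → ℝ), (∀ θ, t θ = Real.sqrt 3 / (2 * Real.sin θ)) → (∀ θ, w₁ θ = Real.sin (2 * Real.pi / 3 - θ) / Real.sin θ) → (∀ θ, w₂ θ = Real.sin (θ - Real.pi / 3) / Real.sin θ) → ∀ θ₁ θ₂ : ℝ, Real.pi / 3 ≤ θ₁ → θ₁ < θ₂ → θ₂ ≤ 2 * Real.pi / 3 → (t (θ₂) * t (θ₂ - θ₁) * w₁ (θ₁) + t (θ₁) + w₂ (θ₁) * t (θ₂) * t (θ₂ - θ₁) = t (θ₂ - θ₁) * t (θ₂) + t (θ₁) ∧ t (θ₂ - θ₁) * t (θ₁) + t (θ₂) = t (θ₂) + t (θ₂ - θ₁) * t (θ₁) * w₂ (θ₂) + t (θ₂ - θ₁) * w₁ (θ₂) * t (θ₁) ∧ t (θ₁) * t (θ₂) + t (θ₂ -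 θ₁) = t (θ₂) * t (θ₁) * w₁ (θ₂ - θ₁) + t (θ₂ - θ₁) + w₂ (θ₂ - θ₁) * t (θ₂) * t (θ₁) ∧ t (θ₂) * t (θ₁) * w₁ (θ₂ - θ₁) + t (θ₂ - θ₁) + t (θ₁) * t (θ₂) * w₂ (θ₂ - θ₁) = t (θ₁) * t (θ₂) + t (θ₂ - θ₁) ∧ t (θ₂ - θ₁) * t (θ₂) + t (θ₁) = t (θ₂) * t (θ₂ - θ₁) * w₁ (θ₁) + t (θ₁) + t (θ₂ - θ₁) * t (θ₂) * w₂ (θ₁) ∧ t (θ₂) + t (θ₂ - θ₁) * t (θ₁) * w₂ (θ₂) + t (θ₁) * w₁ (θ₂) * t (θ₂ - θ₁) = t (θ₂ - θ₁) * t (θ₁) + t (θ₂) ∧ t (θ₂) * w₁ (θ₂ - θ₁) * w₂ (θ₁) + t (θ₂) * w₁ (θ₁) * w₂ (θ₂ - θ₁) + t (θ₂ - θ₁) * t (θ₁) + w₂ (θ₁) * t (θ₂) * w₂ (θ₂ - θ₁) = t (θ₂ - θ₁) * t (θ₁) * w₂ (θ₂) ∧ t (θ₂) * w₁ (θ₂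 - θ₁) * w₁ (θ₁) = t (θ₂ - θ₁) * t (θ₁) * w₁ (θ₂) + t (θ₂) ∧ t (θ₂ - θ₁) * t (θ₂) * w₂ (θ₁) + t (θ₁) = t (θ₁) * w₁ (θ₂ - θ₁) * w₂ (θ₂) ∧ t (θ₂ - θ₁) * t (θ₂) * w₁ (θ₁) = t (θ₂) * t (θ₂ - θ₁) + t (θ₁) * w₁ (θ₂ - θ₁) * w₁ (θ₂) + t (θ₁) * w₂ (θ₂ - θ₁) * w₂ (θ₂) + w₂ (θ₂ - θ₁) * w₁ (θ₂) * t (θ₁) ∧ t (θ₂ - θ₁) * w₂ (θ₁) + t (θ₁) * t (θ₂) = t (θ₂ - θ₁) * w₂ (θ₂) ∧ t (θ₂ - θ₁) * w₁ (θ₁) = t (θ₂ - θ₁) * w₁ (θ₂) + t (θ₁) * t (θ₂) ∧ t (θ₂ - θ₁) * t (θ₁) + t (θ₂) * w₂ (θ₁) = t (θ₂) * w₁ (θ₂ - θ₁) ∧ t (θ₂) * w₁ (θ₁) = t (θ₁) * t (θ₂ - θ₁) + t (θ₂) * w₂ (θ₂ - θ₁) ∧ t (θ₂) * t (θ₁)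 + t (θ₂ - θ₁) * w₁ (θ₁) * w₁ (θ₂) + t (θ₂ - θ₁) * w₂ (θ₁) * w₂ (θ₂) + w₂ (θ₁) * w₁ (θ₂) * t (θ₂ - θ₁) = t (θ₁) * t (θ₂) * w₁ (θ₂ - θ₁) ∧ t (θ₂ - θ₁) * w₁ (θ₁) * w₂ (θ₂) = t (θ₁) * t (θ₂) * w₂ (θ₂ - θ₁) + t (θ₂ - θ₁) ∧ t (θ₁) * w₁ (θ₂ - θ₁) = t (θ₂ - θ₁) * t (θ₂) + t (θ₁) * w₁ (θ₂) ∧ t (θ₁) * w₂ (θ₂ - θ₁) + t (θ₂ - θ₁) * t (θ₂) = t (θ₁) * w₂ (θ₂) ∧ t (θ₁) * t (θ₂) * w₁ (θ₂ - θ₁) = t (θ₂) * t (θ₁) + t (θ₂ - θ₁) * w₁ (θ₁) * w₁ (θ₂) + t (θ₂ - θ₁) * w₂ (θ₁) * w₂ (θ₂) + t (θ₂ - θ₁) * w₁ (θ₂) * w₂ (θ₁) ∧ t (θ₂ - θ₁) * t (θ₁) * w₂ (θ₂) = t (θ₂) * w₁ (θ₂ - θ₁) * w₂ (θ₁) + t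 (θ₂) * w₁ (θ₁) * w₂ (θ₂ - θ₁) + t (θ₂ - θ₁) * t (θ₁) + w₂ (θ₂ - θ₁) * t (θ₂) * w₂ (θ₁) ∧ t (θ₂) * t (θ₂ - θ₁) + t (θ₁) * w₁ (θ₂ - θ₁) * w₁ (θ₂) + t (θ₁) * w₂ (θ₂ - θ₁) * w₂ (θ₂) + t (θ₁) * w₁ (θ₂) * w₂ (θ₂ - θ₁) = t (θ₂ - θ₁) * t (θ₂) * w₁ (θ₁) ∧ t (θ₂) * t (θ₂ - θ₁) * t (θ₁) + w₁ (θ₂ - θ₁) * w₁ (θ₂) * w₂ (θ₁) + w₁ (θ₁) * w₁ (θ₂) * w₂ (θ₂ - θ₁) + w₂ (θ₂ - θ₁) * w₂ (θ₁) * w₂ (θ₂) + w₂ (θ₁) * w₁ (θ₂) * w₂ (θ₂ - θ₁) = w₁ (θ₂ - θ₁) * w₁ (θ₁) * w₂ (θ₂) ∧ w₁ (θ₂ - θ₁) * w₁ (θ₁) * w₂ (θ₂) = t (θ₂) * t (θ₂ - θ₁) * t (θ₁) + w₁ (θ₂ - θ₁) * w₁ (θ₂) * w₂ (θ₁) + w₁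 (θ₁) * w₁ (θ₂) * w₂ (θ₂ - θ₁) + w₂ (θ₂ - θ₁) * w₂ (θ₁) * w₂ (θ₂) + w₂ (θ₂ - θ₁) * w₁ (θ₂) * w₂ (θ₁))

/-- item stmt-CriticalPhenomena-5916 · support · rank 9 · open · by planner
sources: Smirnov2001, BollobasRiordan2006, tree:smirnov_tendsto_triDomainCrossingProb_holds
[support] Smirnov's theorem read on half-plane boundary arcs for the S = ∅ member (i.i.d. fair
colours of ℤ² with edges (1,0), (0,1), (1,−1) = site percolation on 𝕋 = triGraph): P[δ-scaled arcs
[a,b] ↔ [c,d] on the line k = 0 inside k ≥ 0] → cardyFunction(crossRatio(a,b,c,d)). From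
hasCrossingLimit_triDomainCrossingProb (tree) by half-discs + RSW truncation + identification of the
construction with triSitePercolation. [difficulty: M] -/
@[route_item "route-CriticalPhenomena-CardyDiluteOrbit", crux]
def HalfPlaneCardyT : Prop :=
  ∀ a b c d : ℝ, a < b → b < c → c < d → Filter.Tendsto (fun δ : ℝ => let μ := (Literature.Probability.Percolation.sitePercolation ℤ Literature.Probability.Percolation.half).prod ((Literature.Probability.Percolation.sitePercolation ℤ Literature.Probability.Percolation.half).prod ((Literature.Probability.Percolation.sitePercolation (Literature.Probability.LatticeModels.Site 2) (Set.projIcc (0:ℝ) 1 zero_le_one (2 * Real.sqrt 3 - 3))).prod ((Literature.Probability.Percolation.sitePercolation (Literature.Probability.LatticeModels.Site 2) Literature.Probability.Percolation.half).prod (Literature.Probability.Percolation.sitePercolation (Literature.Probability.LatticeModels.Site 2) Literature.Probability.Percolation.half)))); let par : (Set ℤ × (Set ℤ × (Set (Literature.Probability.LatticeModels.Site 2) × (Set (Literature.Probability.LatticeModels.Site 2) × Set (Literature.Probability.LatticeModels.Site 2))))) → Literature.Probability.LatticeModels.Site 2 → Prop := fun ω f => (f 0 ∈ (∅ : Set ℤ)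 ∧ f ∈ ω.2.2.1) ∨ (f 0 ∉ (∅ : Set ℤ) ∧ f ∈ ω.2.2.2.1); let blk : (Set ℤ × (Set ℤ × (Set (Literature.Probability.LatticeModels.Site 2) × (Set (Literature.Probability.LatticeModels.Site 2) × Set (Literature.Probability.LatticeModels.Site 2))))) → Literature.Probability.LatticeModels.Site 2 → Prop := fun ω v => Xor (v 0 ∈ ω.1) (Xor (v 1 ∈ ω.2.1) (Odd ((Finset.filter (fun f : ℤ × ℤ => par ω ![f.1, f.2]) (Finset.Ico (min 0 (v 0)) (max 0 (v 0)) ×ˢ Finset.Ico (min 0 (v 1)) (max 0 (v 1)))).card))); let anti : (Set ℤ × (Set ℤ × (Set (Literature.Probability.LatticeModels.Site 2) × (Set (Literature.Probability.LatticeModels.Site 2) × Set (Literature.Probability.LatticeModels.Site 2))))) → Literature.Probability.LatticeModels.Site 2 → Prop := fun ω f => f 0 ∉ (∅ : Set ℤ) ∨ f ∈ ω.2.2.2.2; let edges : (Set ℤ × (Set ℤ × (Set (Literature.Probability.LatticeModels.Site 2) × (Set (Literature.Probability.LatticeModels.Site 2) × Set (Literature.Probability.LatticeModels.Site 2)))))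 → Literature.Probability.Percolation.BondConfig (Literature.Probability.LatticeModels.Site 2) := fun ω => {e | ∃ u v, e = s(u, v) ∧ blk ω u ∧ blk ω v ∧ (v = u + ![1, 0] ∨ v = u + ![0, 1] ∨ (v = u + ![1, 1] ∧ ¬ anti ω u) ∨ (v = u + ![1, -1] ∧ anti ω (u + ![0, -1])))}; μ.real {ω | edges ω ∈ Literature.Probability.Percolation.openCrossing {v | 0 ≤ v 0} {v | v 0 = 0 ∧ a ≤ δ * (v 1 : ℝ) ∧ δ * (v 1 : ℝ) ≤ b} {v | v 0 = 0 ∧ c ≤ δ * (v 1 : ℝ) ∧ δ * (v 1 : ℝ) ≤ d}}) (nhdsWithin 0 (Set.Ioi 0)) (nhds (Literature.Probability.RandomPlanarGeometry.cardyFunction (Literature.Probability.RandomPlanarGeometry.crossRatio ![a, b, c, d])))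

/-- item stmt-CriticalPhenomena-5917 · support · rank 9 · open · by planner
sources: GlazmanManolescu2019, Smirnov2001
[support] the first Cardy theorem for a ℤ²-based model: half-plane boundary-arc crossing
probabilities of the isotropic IK model converge to Cardy's formula. Immediate from
BoundaryLawInvariance (S = univ vs ∅, integer arcs ⌈a/δ⌉…) and HalfPlaneCardyT. [difficulty: S] -/
@[route_item "route-CriticalPhenomena-CardyDiluteOrbit", crux]
def HalfPlaneCardyIK : Prop :=
  ∀ a b c d : ℝ, a < b → b < c → c < d → Filter.Tendsto (fun δ : ℝ => let μ := (Literature.Probability.Percolation.sitePercolation ℤ Literature.Probability.Percolation.half).prod ((Literature.Probability.Percolation.sitePercolation ℤ Literature.Probability.Percolation.half).prod ((Literature.Probability.Percolation.sitePercolation (Literature.Probability.LatticeModels.Site 2) (Set.projIcc (0:ℝ) 1 zero_le_one (2 * Real.sqrt 3 - 3))).prod ((Literature.Probability.Percolation.sitePercolation (Literature.Probability.LatticeModels.Site 2) Literature.Probability.Percolation.half).prod (Literature.Probability.Percolation.sitePercolation (Literature.Probability.LatticeModels.Site 2) Literature.Probability.Percolation.half)))); let par : (Set ℤ × (Set ℤ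 × (Set (Literature.Probability.LatticeModels.Site 2) × (Set (Literature.Probability.LatticeModels.Site 2) × Set (Literature.Probability.LatticeModels.Site 2))))) → Literature.Probability.LatticeModels.Site 2 → Prop := fun ω f => (f 0 ∈ (Set.univ : Set ℤ) ∧ f ∈ ω.2.2.1) ∨ (f 0 ∉ (Set.univ : Set ℤ) ∧ f ∈ ω.2.2.2.1); let blk : (Set ℤ × (Set ℤ × (Set (Literature.Probability.LatticeModels.Site 2) × (Set (Literature.Probability.LatticeModels.Site 2) × Set (Literature.Probability.LatticeModels.Site 2))))) → Literature.Probability.LatticeModels.Site 2 → Prop := fun ω v => Xor (v 0 ∈ ω.1) (Xor (v 1 ∈ ω.2.1) (Odd ((Finset.filter (fun f : ℤ × ℤ => par ω ![f.1, f.2]) (Finset.Ico (min 0 (v 0)) (max 0 (v 0)) ×ˢ Finset.Ico (min 0 (v 1)) (max 0 (v 1)))).card))); let anti : (Set ℤ × (Set ℤ × (Set (Literature.Probability.LatticeModels.Site 2) × (Set (Literature.Probability.LatticeModels.Site 2) × Set (Literature.Probability.LatticeModels.Site 2))))) → Literature.Probability.LatticeModels.Site 2 → Prop := fun ω f => f 0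 ∉ (Set.univ : Set ℤ) ∨ f ∈ ω.2.2.2.2; let edges : (Set ℤ × (Set ℤ × (Set (Literature.Probability.LatticeModels.Site 2) × (Set (Literature.Probability.LatticeModels.Site 2) × Set (Literature.Probability.LatticeModels.Site 2))))) → Literature.Probability.Percolation.BondConfig (Literature.Probability.LatticeModels.Site 2) := fun ω => {e | ∃ u v, e = s(u, v) ∧ blk ω u ∧ blk ω v ∧ (v = u + ![1, 0] ∨ v = u + ![0, 1] ∨ (v = u + ![1, 1] ∧ ¬ anti ω u) ∨ (v = u + ![1, -1] ∧ anti ω (u + ![0, -1])))}; μ.real {ω | edges ω ∈ Literature.Probability.Percolation.openCrossing {v | 0 ≤ v 0} {v | v 0 = 0 ∧ a ≤ δ * (v 1 : ℝ) ∧ δ * (v 1 : ℝ) ≤ b} {v | v 0 = 0 ∧ c ≤ δ * (v 1 : ℝ) ∧ δ * (v 1 : ℝ) ≤ d}}) (nhdsWithin 0 (Set.Ioi 0)) (nhds (Literature.Probability.RandomPlanarGeometry.cardyFunction (Literature.Probability.RandomPlanarGeometry.crossRatio ![a, b, c, d])))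

/-- item stmt-CriticalPhenomena-5918 · assembly · rank 1 · open · by planner
sources: Smirnov2001, GlazmanManolescu2019
[assembly] CardyIK → IKBondBridge → DiscretisationBridge → CardyFormulaZ2. -/
@[route_item "route-CriticalPhenomena-CardyDiluteOrbit", crux]
def Assembly : Prop :=
  CardyIK → IKBondBridge → DiscretisationBridge → CardyFormulaZ2

/-! D-0027 §2.1 — DECIDING THEOREM (planner-authored via `route open/edit --closes-file`; by operator:999:875655 2026-08-15T14:44:14Z):
its hypotheses are this route's items and its conclusion the sub-problem Statement (glue_lint), and it elaborates with this file. -/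

@[closes "route-CriticalPhenomena-CardyDiluteOrbit"] theorem closes : IKMixedBoxCrossing → BoundaryLawInvariance → CardyIK → IKBondBridge → DiscretisationBridge → IKHexagonYangBaxter → HalfPlaneCardyT → HalfPlaneCardyIK → Assembly → _root_.CardyFormulaZ2 := fun h_IKMixedBoxCrossing h_BoundaryLawInvariance h_CardyIK h_IKBondBridge h_DiscretisationBridge h_IKHexagonYangBaxter h_HalfPlaneCardyT h_HalfPlaneCardyIK h_Assembly => h_Assembly h_CardyIK h_IKBondBridge h_DiscretisationBridge

end Summit.CriticalPhenomena.CardyFormulaZ2.Theses.CardyDiluteOrbit
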